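import Summits.CriticalPhenomena.PercolationContinuityZ3.Theorems.Transplant.SkelFrmBParamsSchedAT
import Summits.CriticalPhenomena.PercolationContinuityZ3.Theorems.Transplant.SkelFrmBParamsExcess
import Summits.CriticalPhenomena.PercolationContinuityZ3.Theorems.Transplant.SkelPhiFatRadius
import Summits.CriticalPhenomena.PercolationContinuityZ3.Theorems.Transplant.SkelConcRootRadii
import Summits.CriticalPhenomena.PercolationContinuityZ3.Theorems.Transplant.SkelNegBParamsSlotsSU
import Summits.CriticalPhenomena.PercolationContinuityZ3.Theorems.Transplant.SkelFrmBParamsSlotsS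
import HarnessLib

/-!
(R-40) `…T` TWIN (stmt-g21, 2026-08-23; ruling p3-g16 06:23:56Z, J18; lead g11 06:35:07Z: the choice function of record moves to `frmChoiceAllQ3T`): the twin of
`SkelFrmBParamsSlotsS` over the PER-AXIS-capped staggered cells `NegB.fcellsT : PCells2T` / the column slot `offNT` / the schedule `schedOfT` / the scheme `ΓQT` / the choices
`choiceAtQ3T` (SkelFrmBChoiceDefsT); statements and proofs VERBATIM with the S ↦ T tokens of record (stmt's table + hp-8 g42's registry renamedT.txt); the CELL-FREE
declarations of `SkelFrmBParamsSlotsS` are NOT re-declared (they serve the T function as landed — `SkelFrmBParamsSlotsS` is imported); NO landed file is edited.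

# N2 (frames-only node `SamePDropOfSkeletonFrm₁`, OPEN) params column over `PlanarSkeletonFrm` — (ζ″) ledger, part SlotsS: THE FIBRE-BLOCK SLOT VALUE OF RECORD OVER THE
# STAGGERED CELLS **`NegB.SUS ex mx : NegB.SSlot`** (the q-level `SchedIn` the schedule of record `schedOfT … c (SUS …)` reads) and every schedule-side binder BY NAME

Hand-assembled twin of N1's `SkelNegBParamsSlotsST` (`GSlot`), `…SlotsSU` (`ψπ`, the root radius `Rπ := E₀ − 1` and the four root radii) and `…SlotsSUA` (the (ζ′) block `SUA`,
`mRA`, `fine_diam_le_mRA`) over `PlanarSkeletonFrm` / `DataNS` / the staggered cells: the block is **`SUS := ⟨max fcellsA.rmax (cOffS+1), 1, 0, ψπ, 0, ex …, Rex (mRS …) q⟩`** —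
N1's `SUA` with the column constant `cOffA ↦ cOffS = 2·cOffA` ((r13-19): the column bound at the staggered centre doubles), everything else VERBATIM (`fcellsT.toPCells2 = fcellsA`, so
`rmax` and the fine diameter are `fcellsA`'s); the root radii are read at `schedOfT … c (Sv …)` (any creep value `c`).
* §1 `GSlot`, `ψπ`/`ψπ_eq`, `mRS` (+ `mRS_ge`), `fine_diam_le_mRS`; §2 **`SUS`**, `SUS_fields`, `SUS_rmax_ge`, **`hgap20_US`/`hgapc_US`/`hgapR_US`/`hgapL_US`**, `ex_le_Lp_US`,
  `three_le_E₀_US`, `hsch_US`, `Rex_mono_US`, **`hR₁_US`/`hRex_US`/`hR₁_US_η`**, `E₀_SUS_eq`, `Lp_SUS_eq`;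
* §3 `Rπ` (any block `Sv`), `Rπ_succ` (N1's `twelve_le_E₀` reused), **`hRQ_RT`/`hRB_RT`/`hRQ'_RT`/`hRM_RT`** at `schedOfT`, `le_Rπ_of`, `le_Rπ_of_reachK`; §4 at `SUS`: `ex_le_Rπ`, `fat_le_Rπ`,
  `Rex_fat_le_Rπ_sub`, `SRex_fat_le_Rπ_sub`.
builds on p205010 (kernel theorem, internal audit signed; external expert review pending) — nothing in this file uses p205010; NOTHING is claimed about the open node
`SamePDropOfSkeletonFrm₁` (`SamePDropOfSkeletonNeg₁` is CLOSED in the tree and untouched by this file).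
Lane `prim-bschramm`, seat `prim-bschramm-stmt` (gen 20); helper file (`--supports stmt-CriticalPhenomena-4575 --as helper`); FRM-PARAMS (t9), (r13-19), (r13-20).
[cite: KozmaNitzan2024, §4 Theorem 6 (pp. 25–31): the order of constants; Lemma 12 (p. 24)] [cite: MartineauTassion2017, §4.3]
-/

noncomputable section

open scoped Classical

namespace Summit.CriticalPhenomena.PercolationContinuityZ3.Theorems.Transplant

namespace PlanarSkeletonFrm

namespace NegB

open MeasureTheory Literature.Probability.Percolation Literature.Probability.LatticeModels SimpleGraph
open Literature.Barriers.CriticalPhenomena (graphBall)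
open SkelConc (Consts)
open BoxProdZ2 (ConcRadiiG Erad Frad nQ)
open Skelφ (oriφ trφ)
open Skelφ.StepI (DataN DataNS)
open Skel (excess)
open Neg

/-! ## §1 The residual slot type, the seed's fat radius, the φ-diameter of a rim habitat -/

-- (cell-free, not re-declared: `GSlot` of SkelFrmBParamsSlotsS)

-- (cell-free, not re-declared: `GSlot.zero` of SkelFrmBParamsSlotsS)

-- (cell-free, not re-declared: `ψπ` of SkelFrmBParamsSlotsS)

-- (cell-free, not re-declared: `ψπ_eq` of SkelFrmBParamsSlotsS)

section Values

variable (κ : Consts) {V : Type} [DecidableEq V] [Countable V] {G : SimpleGraph V} [G.LocallyFinite] (Φ : PlanarSkeletonFrm G) (t : V)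
  (p : unitInterval) (D : DataNS V) (g f mx : ℕ)

-- (cell-free, not re-declared: `mRS` of SkelFrmBParamsSlotsS)

-- (cell-free, not re-declared: `mRS_ge` of SkelFrmBParamsSlotsS)

-- (cell-free, not re-declared: `fine_diam_le_mRS` of SkelFrmBParamsSlotsS)

end Values

/-! ## §2 The fibre block of record over the staggered cells -/

-- (cell-free, not re-declared: `SUS` of SkelFrmBParamsSlotsS)

section Facts

variable (κ : Consts) {V : Type} [DecidableEq V] [Countable V] {G : SimpleGraph V} [G.LocallyFinite] (Φ : PlanarSkeletonFrm G) (t : V)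
  (p : unitInterval) (D : DataNS V) (g f : ℕ) (ex mx : GSlot) (q : unitInterval)

-- (cell-free, not re-declared: `SUS_fields` of SkelFrmBParamsSlotsS)

-- (cell-free, not re-declared: `SUS_rmax_ge` of SkelFrmBParamsSlotsS)

-- (cell-free, not re-declared: `hgap20_US` of SkelFrmBParamsSlotsS)

-- (cell-free, not re-declared: `hgapc_US` of SkelFrmBParamsSlotsS)

-- (cell-free, not re-declared: `hgapR_US` of SkelFrmBParamsSlotsS)

-- (cell-free, not re-declared: `hgapL_US` of SkelFrmBParamsSlotsS)

-- (cell-free, not re-declared: `ex_le_Lp_US` of SkelFrmBParamsSlotsS)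

-- (cell-free, not re-declared: `three_le_E₀_US` of SkelFrmBParamsSlotsS)

-- (cell-free, not re-declared: `hsch_US` of SkelFrmBParamsSlotsS)

-- (cell-free, not re-declared: `Rex_mono_US` of SkelFrmBParamsSlotsS)

-- (cell-free, not re-declared: `hR₁_US` of SkelFrmBParamsSlotsS)

-- (cell-free, not re-declared: `hRex_US` of SkelFrmBParamsSlotsS)

-- (cell-free, not re-declared: `hR₁_US_η` of SkelFrmBParamsSlotsS)

-- (cell-free, not re-declared: `E₀_SUS_eq` of SkelFrmBParamsSlotsS)

-- (cell-free, not re-declared: `Lp_SUS_eq` of SkelFrmBParamsSlotsS)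

end Facts

/-! ## §3 The root radius `Rπ := E₀ − 1` (any block) and the four root radii at the schedule of record -/

section RootRadii

variable (κ : Consts) {V : Type} [DecidableEq V] [Countable V] {G : SimpleGraph V} [G.LocallyFinite] (Φ : PlanarSkeletonFrm G) (t : V)
  (p : unitInterval) (D : DataNS V) (g f : ℕ) (c : Fin 2 → ℕ) (Sv : SSlot) (q : unitInterval)

-- (cell-free, not re-declared: `Rπ` of SkelFrmBParamsSlotsS)

-- (cell-free, not re-declared: `Rπ_succ` of SkelFrmBParamsSlotsS)

/-- **`hRQ`**: `Rπ + 1 ≤ rQ 0 0` (`rQ 0 0 = E (nQ 0 0) ⊔ … ≥ E₀`). [folklore] -/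
theorem hRQ_RT : Rπ κ Φ t p D g f Sv q + 1 ≤ (schedOfT κ Φ t p D g f c (Sv κ Φ t p D g f q)).rQ 0 0 := by
  rw [Rπ_succ]
  show _ ≤ max (Erad (Skelφ.Prm.gap (Sv κ Φ t p D g f q)) (fun _ => 0) (Skelφ.Prm.E₀ (Sv κ Φ t p D g f q)) (nQ 0 0)) _
  exact le_trans (Skel.E₀_le_Erad _ _ _ _) (le_max_left _ _)

/-- **`hRB`**: `Rπ + 1 ≤ rB 0 0 du` (`= E (nQ 0 (0+du))`). [folklore] -/
theorem hRB_RT (du : MDir) : Rπ κ Φ t p D g f Sv q + 1 ≤ (schedOfT κ Φ t p D g f c (Sv κ Φ t p D g f q)).rB 0 0 du := by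
  rw [Rπ_succ]
  show _ ≤ Erad (Skelφ.Prm.gap (Sv κ Φ t p D g f q)) (fun _ => 0) (Skelφ.Prm.E₀ (Sv κ Φ t p D g f q)) (nQ 0 (0 + stepVec du))
  exact Skel.E₀_le_Erad _ _ _ _

/-- **`hRQ′`**: `Rπ + 1 ≤ rQ 0 (0 + du)`. [folklore] -/
theorem hRQ'_RT (du : MDir) : Rπ κ Φ t p D g f Sv q + 1 ≤ (schedOfT κ Φ t p D g f c (Sv κ Φ t p D g f q)).rQ 0 ((0 : Site 2) + stepVec du) := by
  rw [Rπ_succ]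
  show _ ≤ max (Erad (Skelφ.Prm.gap (Sv κ Φ t p D g f q)) (fun _ => 0) (Skelφ.Prm.E₀ (Sv κ Φ t p D g f q)) (nQ 0 ((0 : Site 2) + stepVec du))) _
  exact le_trans (Skel.E₀_le_Erad _ _ _ _) (le_max_left _ _)

/-- **`hRM`**: `Rπ + 1 ≤ rM 0 (0 + du)` (`rM 0 (0+du) = F 1 − L′ = E₀ + gap E₀ − L′ ≥ E₀` since `L′ ≤ gap`). [folklore] -/
theorem hRM_RT (du : MDir) : Rπ κ Φ t p D g f Sv q + 1 ≤ (schedOfT κ Φ t p D g f c (Sv κ Φ t p D g f q)).rM 0 ((0 : Site 2) + stepVec du) := by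
  rw [Rπ_succ]
  show _ ≤ Frad (Skelφ.Prm.gap (Sv κ Φ t p D g f q)) (fun _ => 0) (Skelφ.Prm.E₀ (Sv κ Φ t p D g f q)) (nQ 0 ((0 : Site 2) + stepVec du)) - Skelφ.Prm.Lp (Sv κ Φ t p D g f q)
  rw [Skel.nQ_zero_stepVec, BoxProdZ2.Frad_succ, BoxProdZ2.Erad_zero]
  have h := Skelφ.Prm.hgapL (Sv κ Φ t p D g f q) (Skelφ.Prm.E₀ (Sv κ Φ t p D g f q))
  omega

-- (cell-free, not re-declared: `le_Rπ_of` of SkelFrmBParamsSlotsS)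

-- (cell-free, not re-declared: `le_Rπ_of_reachK` of SkelFrmBParamsSlotsS)

end RootRadii

/-! ## §4 The `Rπ`-inequalities of the root residue at `SUS`, as floors on `ex` -/

section RootSU

variable (κ : Consts) {V : Type} [DecidableEq V] [Countable V] {G : SimpleGraph V} [G.LocallyFinite] (Φ : PlanarSkeletonFrm G) (t : V)
  (p : unitInterval) (D : DataNS V) (g f : ℕ) (ex mx : GSlot) (q : unitInterval)

-- (cell-free, not re-declared: `ex_le_Rπ` of SkelFrmBParamsSlotsS)

-- (cell-free, not re-declared: `fat_le_Rπ` of SkelFrmBParamsSlotsS)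

-- (cell-free, not re-declared: `Rex_fat_le_Rπ_sub` of SkelFrmBParamsSlotsS)

-- (cell-free, not re-declared: `SRex_fat_le_Rπ_sub` of SkelFrmBParamsSlotsS)

end RootSU

end NegB

end PlanarSkeletonFrm

end Summit.CriticalPhenomena.PercolationContinuityZ3.Theorems.Transplant

end
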